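import Summits.FinalStateConjecture.FinalStateConjecture.Theorems.EIHFluxBalanceInertialRecessionLorentz

/-!
# `ModulatedKerrHandoff` H′ (crux `stmt-FinalStateConjecture-17402`, route EIHFluxBalance, rank 3) —
# negative-side lemmas III: the handoff clause (O) is RIGID in lab time

Refuter seat `refuter-cdisprove-stmt-FinalStateConjecture-17402-0` (standing disprover of H′, cycle 1,
2026-08-17; workfile `Cruxes/ModulatedKerrHandoff/Disproof.lean` §13). Tightness analysis of one clause
of the re-typed crux (cdisprove protocol (b)); `sorry`-free, no definitions, no named facts.

Clause (O) of H′ (rev 6) demands that every painted frame be ORTHOCHRONOUS AT ALL LAB TIMES,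
`∀ i t, 0 < (Λᵢ(t) e₀)⁰`, while clause (3) makes `t ↦ Λᵢ(t)` smooth (in particular continuous as a map
into `E4 →L[ℝ] E4`) and clause (2) bounds the Lorentz factor, `|(Λᵢ(t) e₀)⁰| ≤ γ`.

* `orthochronous_forall_iff_zero` — given the continuity of clause (3), (O) for all `t` is EQUIVALENT
  to (O) at the single instant `t = 0`: the time component `(Λ(t)e₀)⁰` of `Λ(t) ∈ O(1,3)` has absolute
  value `≥ 1` (`one_le_abs_lorentz_apply_zero`) and varies continuously, so by the intermediate value
  theorem its sign is constant on `ℝ`. Consequences for the crux: the `∀ t` in (O) carries no content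
  beyond one instant (a planner may weaken it for free); conversely a witness chart whose painting is
  time-reversed at one late time is time-reversed at all times — (O) cannot be "repaired late".
* `one_le_lorentz_apply_zero_of_pos` — with (O), clause (2) reads `1 ≤ (Λᵢ(t)e₀)⁰ ≤ γ`; in particular
  `1 ≤ γ` as soon as there is a hole (`one_le_gamma_of_orthochronous`).

## References

* B. O'Neill, *Semi-Riemannian Geometry* (1983), Ch. 9, pp. 233–236 (the four components of `O(1,3)`;
  the orthochronous subgroup).
-/

noncomputable section

-- the doubled `FinalStateConjecture.FinalStateConjecture` path component trips dupNamespace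
set_option linter.dupNamespace false

open Set Function Filter
open scoped Topology

namespace Summit.FinalStateConjecture.FinalStateConjecture.Theorems.ModulatedKerrHandoff.Negative

open Literature.Geometry.Lorentzian
open Summit.FinalStateConjecture.FinalStateConjecture.Theorems (one_le_abs_lorentz_apply_zero)

/-- **(O) FOR ALL `t` IS (O) AT ONE INSTANT, given the continuity of clause (3).** For a continuous
path `t ↦ Λ(t)` in `O(1,3)` (continuity of the underlying operators suffices), the painted frame is
orthochronous at all lab times iff it is at `t = 0`: `|(Λ(t)e₀)⁰| ≥ 1` for every Lorentz
transformation and `t ↦ (Λ(t)e₀)⁰` is continuous, so a sign change would produce a zero by the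
intermediate value theorem. [cite: ONeill1983, Ch. 9  pp. 233–236] -/
theorem orthochronous_forall_iff_zero {Λ : ℝ → lorentzGroup}
    (hΛ : Continuous fun t ↦ ((Λ t : E4 ≃L[ℝ] E4) : E4 →L[ℝ] E4)) :
    (∀ t, 0 < ((Λ t : E4 ≃L[ℝ] E4) (E4.basisVector 0)) 0) ↔
      0 < ((Λ 0 : E4 ≃L[ℝ] E4) (E4.basisVector 0)) 0 := by
  refine ⟨fun h ↦ h 0, fun h0 t ↦ ?_⟩
  set f : ℝ → ℝ := fun s ↦ ((Λ s : E4 ≃L[ℝ] E4) (E4.basisVector 0)) 0 with hf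
  have hfc : Continuous f := by
    have h1 : Continuous fun s ↦ ((Λ s : E4 ≃L[ℝ] E4) : E4 →L[ℝ] E4) (E4.basisVector 0) :=
      hΛ.clm_apply continuous_const
    exact (EuclideanSpace.proj (0 : Fin 4)).continuous.comp h1
  by_contra hle
  push Not at hle
  have hsub : Icc (f t) (f 0) ⊆ range f := intermediate_value_univ t 0 hfc
  obtain ⟨s, hs⟩ := hsub ⟨hle, h0.le⟩
  have h1 := one_le_abs_lorentz_apply_zero (Λ s)
  have h2 : ((Λ s : E4 ≃L[ℝ] E4) (E4.basisVector 0)) 0 = 0 := hs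
  rw [h2, abs_zero] at h1
  linarith

/-- **The clause as written in the crux** (smoothness of clause (3) in, (O) out): under
`ContDiff ℝ ∞ (t ↦ Λᵢ(t))` for every hole, (O) for all holes and times is equivalent to (O) for all
holes at `t = 0`. [cite: ONeill1983, Ch. 9  pp. 233–236] -/
theorem clauseO_iff_at_zero {N : ℕ} {Λ : Fin N → ℝ → lorentzGroup}
    (h3 : ∀ i, ContDiff ℝ ((⊤ : ℕ∞) : WithTop ℕ∞) (fun t ↦ ((Λ i t : E4 ≃L[ℝ] E4) : E4 →L[ℝ] E4))) :
    (∀ (i : Fin N) (t : ℝ), 0 < (((Λ i t : lorentzGroup) : E4 ≃L[ℝ] E4) (E4.basisVector 0)) 0) ↔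
      ∀ i : Fin N, 0 < (((Λ i 0 : lorentzGroup) : E4 ≃L[ℝ] E4) (E4.basisVector 0)) 0 :=
  ⟨fun h i ↦ h i 0, fun h i ↦ (orthochronous_forall_iff_zero (h3 i).continuous).2 (h i)⟩

/-- **With (O), the Lorentz-factor bound (2) reads `1 ≤ (Λe₀)⁰ ≤ γ`.** [cite: ONeill1983, Ch. 9  pp. 233–236] -/
theorem one_le_lorentz_apply_zero_of_pos {Λ : lorentzGroup}
    (h : 0 < ((Λ : E4 ≃L[ℝ] E4) (E4.basisVector 0)) 0) :
    1 ≤ ((Λ : E4 ≃L[ℝ] E4) (E4.basisVector 0)) 0 := by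
  have := one_le_abs_lorentz_apply_zero Λ
  rwa [abs_of_pos h] at this

/-- **Hence `γ ≥ 1` as soon as there is a hole**: clauses (2) and (O) of H′ force `1 ≤ γ` for `N ≠ 0`
(for `N = 0` the Lorentz-factor bound `γ` is unconstrained junk). [cite: ONeill1983, Ch. 9  pp. 233–236] -/
theorem one_le_gamma_of_orthochronous {N : ℕ} (hN : N ≠ 0) {Λ : Fin N → ℝ → lorentzGroup} {γ : ℝ}
    (h2 : ∀ i t, |((Λ i t : E4 ≃L[ℝ] E4) (E4.basisVector 0)) 0| ≤ γ)
    (hO : ∀ (i : Fin N) (t : ℝ), 0 < (((Λ i t : lorentzGroup) : E4 ≃L[ℝ] E4) (E4.basisVector 0)) 0) :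
    1 ≤ γ := by
  have i : Fin N := ⟨0, Nat.pos_of_ne_zero hN⟩
  have h := h2 i 0
  rw [abs_of_pos (hO i 0)] at h
  exact (one_le_lorentz_apply_zero_of_pos (hO i 0)).trans h

end Summit.FinalStateConjecture.FinalStateConjecture.Theorems.ModulatedKerrHandoff.Negative

end
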